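import Literature.NumberTheory.EllipticCurves.ZpCorankCyclotomicDivisibility
import HarnessLib

/-!
# An automorphism of order `p^(n+1)` changes the `ℤ_p`-corank of the `σ^(p^n)`-invariants by a multiple of `φ(p^(n+1)) = p^n (p - 1)`

Sibling of `ZpCorankCyclotomicDivisibility` (the case `n = 0`). Pure algebra behind the last
paragraph of the proof of Theorem 4.19 (= Thm. 1.4) of T. Dokchitser, V. Dokchitser, *On the
Birch–Swinnerton-Dyer quotients modulo squares*, Ann. of Math. 172 (2010), 567–596, §4.6 (p. 27;
arXiv:math/0610290, proof of Thm. 52): with `F = M_{n+1} ⊃ M = M_n ⊃ M_0` the layers of the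
anticyclotomic `ℤ_p`-extension, `Gal(F/M_0) ≅ C_{p^(n+1)}` generated by `g`, `Gal(F/M) = ⟨g^(p^n)⟩`,
and `X = X_p(E/F)`: "So `X` contains exactly one copy of the unique `(p-1)p^n`-dimensional
`ℚ_p`-irreducible `p`-adic representation of `Gal(F/ℚ)`. Its restriction to `H` is `ρ^{⊕p^n}`,
and no other representation contributes to `ρ`, so `m_ρ = p^n` is odd." The representation
theory in that sentence is: the `g^(p^n)`-coinvariant-free part of a `ℚ_p[C_{p^(n+1)}]`-module is a
`ℚ_p(ζ_{p^(n+1)})`-vector space, of `ℚ_p`-dimension `φ(p^(n+1))·a = (p-1)·p^n·a` where `a` is the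
number of copies of the faithful `ℚ_p`-irreducible representation; hence
`rk_p(E/M_{n+1}) - rk_p(E/M_n) = (p - 1)·m_ρ` with `m_ρ = p^n·a`, and the deep input
(Cornut–Vatsal with Tian–Zhang / Nekovář) is exactly `a = 1`.

On the tree's model of `ℤ_p`-coranks (`zpCorank A p = dim A[p] − dim A/pA` for `p`-primary abelian
groups with finite `p`-torsion, files `Selmer`, `ZpCorankQuasiIso`) this file proves, on the
Pontryagin-dual (discrete) side and without representation theory over `ℚ_p`:

* `exists_zpCorank_eq_mul_of_pow_add_eq_zero` — **the Eisenstein engine**, abstracted from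
  `ZpCorankCyclotomicDivisibility.exists_zpCorank_eq_mul_of_sum_pow_eq_zero`: if an endomorphism
  `π` of a `p`-primary `B` with finite `B[p]` satisfies `π^d + p·Q(π) = 0` with `d ≠ 0` and
  `Q = 1 + X·V ∈ ℤ[X]`, then `d ∣ zpCorank B p`;
* `exists_cyclotomic_prime_pow_comp_X_add_one_eq` — `Φ_{p^(n+1)}(X + 1) = X^(p^n (p-1)) + p·Q` with
  `Q = 1 + X·V` (Mathlib's `cyclotomic_prime_pow_comp_X_add_one_isEisensteinAt` and
  `eval_one_cyclotomic_prime_pow`);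
* `exists_zpCorank_eq_totient_mul_of_aeval_cyclotomic_eq_zero` — a `p`-primary `B` with finite
  `B[p]` killed by `Φ_{p^(n+1)}(g)` for an endomorphism `g` has corank `p^n (p-1)·a`
  (a cofinitely generated torsion `ℤ_p[ζ_{p^(n+1)}]`-module has `ℤ_p`-corank divisible by
  `[ℚ_p(ζ_{p^(n+1)}) : ℚ_p]`);
* `zpCorank_eq_zpCorank_fixedSub_add_zpCorank_kerNorm` — for `σ^p = 1`:
  `corank A = corank A^σ + corank ker N_σ` (the decomposition inside
  `exists_zpCorank_eq_zpCorank_fixedSub_add`, exposed);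
* `exists_zpCorank_eq_zpCorank_fixedSub_pow_add` — **for an endomorphism `g` with
  `g^(p^(n+1)) = 1`: `corank A = corank A^(g^(p^n)) + p^n (p-1)·a`** for some `a : ℕ`, because
  `N_{g^(p^n)} = ∑_{i<p} g^(p^n i) = Φ_{p^(n+1)}(g)` (`cyclotomic_prime_pow_eq_geom_sum`).

Everything here is proved; no named fact is introduced; there is no number theory in this file.

## References

* [DokchitserDokchitserAnnals2010] T. Dokchitser, V. Dokchitser, Ann. of Math. 172 (2010),
  567–596 = arXiv:math/0610290, §4.6, proof of Thm. 4.19 (p. 27), and §4.4, Cor. 4.15.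
* [Greenberg1999] R. Greenberg, *Iwasawa theory for elliptic curves*, LNM 1716 (1999), §1.
-/

noncomputable section

open Function Polynomial
open scoped AddSubgroup

namespace Literature.NumberTheory.EllipticCurves

/-! ## The Eisenstein engine: `π^d = -p·Q(π)` with `Q(π) = 1 + π V(π)` -/

section Engine

variable {B : Type*} [AddCommGroup B] {p : ℕ} [hp : Fact p.Prime] {π : AddMonoid.End B} {d : ℕ}
  {Q V : ℤ[X]}

omit hp in
/-- `(f + g) x = f x + g x` in `AddMonoid.End` (pointwise addition; `rfl`, recorded because the
generic `AddMonoidHom.add_apply` does not match the `AddMonoid.End` instances syntactically).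
[folklore] -/
theorem addMonoidEnd_add_apply (f g : AddMonoid.End B) (x : B) : (f + g) x = f x + g x := rfl

omit hp in
/-- `(f - g) x = f x - g x` in `AddMonoid.End`. [folklore] -/
theorem addMonoidEnd_sub_apply (f g : AddMonoid.End B) (x : B) : (f - g) x = f x - g x := rfl

omit hp in
/-- `(-f) x = -(f x)` in `AddMonoid.End`. [folklore] -/
theorem addMonoidEnd_neg_apply (f : AddMonoid.End B) (x : B) : (-f) x = -(f x) := rfl

omit hp in
/-- **`π` is locally nilpotent**: if `π^d + p·Q(π) = 0` then `π^(d n)` kills `B[p^n]`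
(`Q(π)` commutes with `π`). [folklore] -/
theorem pow_mul_apply_eq_zero_of_pow_nsmul_eq_zero
    (hE : π ^ d + (p : AddMonoid.End B) * aeval π Q = 0) (n : ℕ) (b : B) (hb : p ^ n • b = 0) :
    (π ^ (d * n)) b = 0 := by
  have hcomm : ∀ m : ℕ, π ^ m * aeval π Q = aeval π Q * π ^ m := fun m ↦ by
    have h := aeval_mul_comm π (X ^ m) Q
    rwa [map_pow, aeval_X] at h
  induction n generalizing b with
  | zero => rw [pow_zero, one_smul] at hb; rw [hb, map_zero]
  | succ n ih =>
    have hstep : (π ^ d) b = -(aeval π Q (p • b)) := by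
      have h1 : π ^ d = -((p : AddMonoid.End B) * aeval π Q) := eq_neg_of_add_eq_zero_left hE
      rw [h1]
      change -(((p : AddMonoid.End B) * aeval π Q) b) = _
      rw [AddMonoid.End.coe_mul, comp_apply, AddMonoid.End.natCast_apply, map_nsmul]
    have hpb : p ^ n • (p • b) = 0 := by rw [smul_smul, ← pow_succ, hb]
    rw [Nat.mul_succ, pow_add, AddMonoid.End.coe_mul, comp_apply, hstep, map_neg,
      ← comp_apply (f := ⇑(π ^ (d * n))) (g := ⇑(aeval π Q)), ← AddMonoid.End.coe_mul,
      hcomm, AddMonoid.End.coe_mul, comp_apply, ih (p • b) hpb, map_zero, neg_zero]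

omit hp in
/-- Local nilpotence of `π` on a `p`-primary `B` with `π^d + p·Q(π) = 0`. [folklore] -/
theorem exists_pow_apply_eq_zero_of_pow_add_eq_zero
    (hE : π ^ d + (p : AddMonoid.End B) * aeval π Q = 0)
    (hB : ∀ b : B, ∃ n : ℕ, p ^ n • b = 0) (b : B) : ∃ m : ℕ, (π ^ m) b = 0 := by
  obtain ⟨n, hn⟩ := hB b
  exact ⟨d * n, pow_mul_apply_eq_zero_of_pow_nsmul_eq_zero hE n b hn⟩

omit hp in
/-- **`Q(π) = 1 + π V(π)` is injective** (`π` locally nilpotent). [folklore] -/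
theorem aeval_injective_of_pow_add_eq_zero
    (hE : π ^ d + (p : AddMonoid.End B) * aeval π Q = 0)
    (hB : ∀ b : B, ∃ n : ℕ, p ^ n • b = 0) (hQV : Q = 1 + X * V) :
    Function.Injective (aeval π Q) := by
  rw [injective_iff_map_eq_zero]
  intro b hb
  have hY : ∀ m : ℕ, aeval π ((-(X * V)) ^ m) b = b := by
    intro m
    induction m with
    | zero => rw [pow_zero, map_one]; rfl
    | succ m ih =>
      have h1 : aeval π (-(X * V)) b = b := by
        have h2 : aeval π Q b = aeval π (1 + X * V) b := by rw [hQV]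
        rw [hb, map_add, map_one] at h2
        change (0 : B) = b + aeval π (X * V) b at h2
        rw [map_neg]
        change -(aeval π (X * V) b) = b
        rw [neg_eq_iff_add_eq_zero, add_comm]
        exact h2.symm
      conv_rhs => rw [← ih, ← h1]
      rw [pow_succ, map_mul, AddMonoid.End.coe_mul, comp_apply]
  obtain ⟨m, hm⟩ := exists_pow_apply_eq_zero_of_pow_add_eq_zero hE hB b
  rw [← hY m, neg_pow, mul_pow, show (-1 : ℤ[X]) ^ m * (X ^ m * V ^ m) = ((-1) ^ m * V ^ m) * X ^ m
    by ring]
  exact aeval_mul_X_pow_apply_eq_zero π _ hm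

omit hp in
/-- **`Q(π) = 1 + π V(π)` is surjective** (geometric series in the locally nilpotent `π V(π)`).
[folklore] -/
theorem aeval_surjective_of_pow_add_eq_zero
    (hE : π ^ d + (p : AddMonoid.End B) * aeval π Q = 0)
    (hB : ∀ b : B, ∃ n : ℕ, p ^ n • b = 0) (hQV : Q = 1 + X * V) :
    Function.Surjective (aeval π Q) := by
  intro b
  obtain ⟨m, hm⟩ := exists_pow_apply_eq_zero_of_pow_add_eq_zero hE hB b
  refine ⟨aeval π (∑ j ∈ Finset.range m, (-(X * V)) ^ j) b, ?_⟩
  rw [← comp_apply (f := ⇑(aeval π Q)), ← AddMonoid.End.coe_mul, ← map_mul,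
    show Q = 1 - -(X * V) by rw [hQV]; ring, mul_neg_geom_sum, map_sub, map_one]
  change b - aeval π ((-(X * V)) ^ m) b = b
  rw [neg_pow, mul_pow, show (-1 : ℤ[X]) ^ m * (X ^ m * V ^ m) = ((-1) ^ m * V ^ m) * X ^ m by ring,
    aeval_mul_X_pow_apply_eq_zero π _ hm, sub_zero]

omit hp in
/-- **`ker π ⊆ B[p]`**: if `π b = 0` then `0 = (π^d + p Q(π)) b = p • b` (`d ≠ 0`, `Q(0) = 1`).
[folklore] -/
theorem nsmul_eq_zero_of_apply_eq_zero
    (hE : π ^ d + (p : AddMonoid.End B) * aeval π Q = 0) (hQV : Q = 1 + X * V) (hd : d ≠ 0)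
    {b : B} (hb : π b = 0) : p • b = 0 := by
  obtain ⟨e, rfl⟩ : ∃ e, d = e + 1 := ⟨d - 1, (Nat.succ_pred_eq_of_ne_zero hd).symm⟩
  have h : (π ^ (e + 1) + (p : AddMonoid.End B) * aeval π Q) b = (0 : AddMonoid.End B) b :=
    congrArg (fun f : AddMonoid.End B ↦ f b) hE
  rw [addMonoidEnd_add_apply, pow_succ, AddMonoid.End.coe_mul, comp_apply, hb, map_zero, zero_add,
    AddMonoid.End.coe_mul, comp_apply, AddMonoid.End.natCast_apply, hQV, map_add, map_one,
    addMonoidEnd_add_apply, mul_comm X V, map_mul, aeval_X, AddMonoid.End.coe_mul, comp_apply, hb,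
    map_zero, add_zero] at h
  exact h

omit hp in
/-- **`pB ⊆ πB`**: `p • b = -π^d c` where `b = Q(π) c`. [folklore] -/
theorem nsmul_mem_range_of_pow_add_eq_zero
    (hE : π ^ d + (p : AddMonoid.End B) * aeval π Q = 0)
    (hB : ∀ b : B, ∃ n : ℕ, p ^ n • b = 0) (hQV : Q = 1 + X * V) (hd : d ≠ 0) (b : B) :
    p • b ∈ AddMonoidHom.range π := by
  obtain ⟨e, rfl⟩ : ∃ e, d = e + 1 := ⟨d - 1, (Nat.succ_pred_eq_of_ne_zero hd).symm⟩
  obtain ⟨c, rfl⟩ := aeval_surjective_of_pow_add_eq_zero hE hB hQV b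
  have h1 : (p : AddMonoid.End B) * aeval π Q = -π ^ (e + 1) := eq_neg_of_add_eq_zero_right hE
  refine ⟨-((π ^ e) c), ?_⟩
  rw [map_neg, ← AddMonoid.End.natCast_apply, ← comp_apply (f := ⇑(p : AddMonoid.End B)),
    ← AddMonoid.End.coe_mul, h1]
  change -(π ((π ^ e) c)) = -((π ^ (e + 1)) c)
  rw [pow_succ', AddMonoid.End.coe_mul, comp_apply]

/-- **The Eisenstein engine.** A `p`-primary abelian group `B` with finite `B[p]` carrying an
endomorphism `π` with `π^d + p·Q(π) = 0`, `d ≠ 0`, `Q = 1 + X·V`, has `ℤ_p`-corank divisible by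
`d`: `Q(π)` is an automorphism commuting with `π`, so `π^d = (-Q(π)) ∘ p` and the multiplicativity
of the kernel–cokernel index (`natCard_ker_pow_mul_index_pow`) gives
`#B[p]·[B:πB]^d = (#ker π)^d·#(B/pB)`; as `ker π ⊆ B[p]` and `B/πB` (a quotient of `B/pB`) are
finite and killed by `p`, reading orders as powers of `p` gives `corank B = d(a - b)`. (For a
cofinitely generated torsion module over the ring of integers of a totally ramified extension of
`ℚ_p` of degree `d` this is `corank_{ℤ_p} = d · corank_{𝓞}`.) The case `d = p - 1`,
`π = τ - 1` with `1 + τ + ⋯ + τ^(p-1) = 0` is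
`ZpCorankCyclotomicDivisibility.exists_zpCorank_eq_mul_of_sum_pow_eq_zero`, whose proof this one
repeats verbatim. [folklore] -/
theorem exists_zpCorank_eq_mul_of_pow_add_eq_zero
    (hE : π ^ d + (p : AddMonoid.End B) * aeval π Q = 0) (hQV : Q = 1 + X * V) (hd : d ≠ 0)
    (hB : ∀ b : B, ∃ n : ℕ, p ^ n • b = 0) [Finite B[(p : ℤ)]] :
    ∃ k : ℕ, zpCorank B p = d * k := by
  have hqinj : Function.Injective (aeval π Q) := aeval_injective_of_pow_add_eq_zero hE hB hQV
  have hqsurj : Function.Surjective (aeval π Q) := aeval_surjective_of_pow_add_eq_zero hE hB hQV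
  set q : AddMonoid.End B := aeval π Q with hq
  -- `π^d = (-q) ∘ p`
  have hfactor : π ^ d = (-q) * (p : AddMonoid.End B) := by
    rw [neg_mul, ← (Nat.cast_commute p q).eq]
    exact eq_neg_of_add_eq_zero_left hE
  have hnqinj : Function.Injective (-q) := fun a b h ↦ by
    change -(q a) = -(q b) at h
    exact hqinj (neg_inj.mp h)
  have hnqsurj : Function.Surjective (-q) := fun b ↦ by
    obtain ⟨c, hc⟩ := hqsurj (-b)
    exact ⟨c, by change -(q c) = b; rw [← neg_neg b]; exact congrArg Neg.neg hc⟩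
  have hker : Nat.card (AddMonoidHom.ker (π ^ d)) = Nat.card B[(p : ℤ)] := by
    rw [hfactor, ker_mul_of_injective hnqinj, natCard_ker_natCast_eq]
  have hidx : (AddMonoidHom.range (π ^ d)).index = Nat.card (ModN B p) := by
    rw [hfactor, index_range_mul_of_bijective ⟨hnqinj, hnqsurj⟩, index_range_natCast_eq]
  -- finiteness of `B/pB`, hence of `B/πB`
  obtain ⟨hfinModN, -⟩ := finite_modN_of_primary hB
  have hModN0 : Nat.card (ModN B p) ≠ 0 := (Nat.card_pos (α := ModN B p)).ne'
  have hle : AddMonoidHom.range (p : AddMonoid.End B) ≤ AddMonoidHom.range π := by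
    rintro _ ⟨b, rfl⟩
    change (p : AddMonoid.End B) b ∈ AddMonoidHom.range π
    rw [AddMonoid.End.natCast_apply]
    exact nsmul_mem_range_of_pow_add_eq_zero hE hB hQV hd b
  have hc1 : (AddMonoidHom.range π).index ≠ 0 := by
    intro h0
    have hdvd := AddSubgroup.index_dvd_of_le hle
    rw [h0, zero_dvd_iff, index_range_natCast_eq] at hdvd
    exact hModN0 hdvd
  -- the iterate identity at `m = d`
  have hiter := natCard_ker_pow_mul_index_pow π hc1 d
  rw [hker, hidx, ← pow_zpCorank_mul_natCard_modN hB] at hiter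
  -- `#ker π = p^a`, `[B : πB] = p^b`
  haveI : Finite (AddMonoidHom.ker π) := by
    refine Finite.of_injective (fun x : AddMonoidHom.ker π ↦ (⟨(x : B),
      AddSubgroup.torsionBy.nsmul_iff.mpr (nsmul_eq_zero_of_apply_eq_zero hE hQV hd x.2)⟩ :
        B[(p : ℤ)])) fun x y hxy ↦ Subtype.ext (congrArg (fun z : B[(p : ℤ)] ↦ (z : B)) hxy)
  obtain ⟨a, ha⟩ := exists_natCard_eq_prime_pow_of_nsmul_eq_zero (p := p) (AddMonoidHom.ker π)
    fun x ↦ Subtype.ext (by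
      rw [AddSubgroupClass.coe_nsmul, ZeroMemClass.coe_zero]
      exact nsmul_eq_zero_of_apply_eq_zero hE hQV hd x.2)
  haveI : Finite (B ⧸ AddMonoidHom.range π) := (AddSubgroup.fintypeOfIndexNeZero hc1).finite
  obtain ⟨b, hb⟩ := exists_natCard_eq_prime_pow_of_nsmul_eq_zero (p := p) (B ⧸ AddMonoidHom.range π)
    fun x ↦ by
      induction x using QuotientAddGroup.induction_on with
      | H y =>
        rw [← QuotientAddGroup.mk_nsmul, QuotientAddGroup.eq_zero_iff]
        exact nsmul_mem_range_of_pow_add_eq_zero hE hB hQV hd y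
  rw [← AddSubgroup.index_eq_card] at hb
  rw [ha, hb] at hiter
  refine ⟨a - b, ?_⟩
  have h1 : p ^ (zpCorank B p + b * d) = p ^ (a * d) := by
    apply Nat.eq_of_mul_eq_mul_right (Nat.pos_of_ne_zero hModN0)
    calc p ^ (zpCorank B p + b * d) * Nat.card (ModN B p)
        = p ^ zpCorank B p * Nat.card (ModN B p) * (p ^ b) ^ d := by ring
      _ = (p ^ a) ^ d * Nat.card (ModN B p) := hiter
      _ = p ^ (a * d) * Nat.card (ModN B p) := by ring
  have h2 := Nat.pow_right_injective hp.out.two_le h1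
  have h3 : zpCorank B p = a * d - b * d := by omega
  rw [h3, ← Nat.sub_mul, mul_comm]

end Engine

/-! ## `Φ_{p^(n+1)}(X + 1) = X^(p^n (p-1)) + p·Q` with `Q(0) = 1` -/

section CyclotomicShift

/-- **The shifted prime-power cyclotomic polynomial is Eisenstein at `p`, explicitly**: there are
`Q, V ∈ ℤ[X]` with `Φ_{p^(n+1)}(X + 1) = X^(p^n (p - 1)) + p·Q` and `Q = 1 + X·V` (Mathlib's
`cyclotomic_prime_pow_comp_X_add_one_isEisensteinAt`; the constant coefficient is
`Φ_{p^(n+1)}(1) = p`, `eval_one_cyclotomic_prime_pow`). [folklore] -/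
theorem exists_cyclotomic_prime_pow_comp_X_add_one_eq (p : ℕ) [hp : Fact p.Prime] (n : ℕ) :
    ∃ Q V : ℤ[X], (cyclotomic (p ^ (n + 1)) ℤ).comp (X + 1) = X ^ (p ^ n * (p - 1)) + C (p : ℤ) * Q ∧
      Q = 1 + X * V := by
  set P : ℤ[X] := (cyclotomic (p ^ (n + 1)) ℤ).comp (X + 1) with hP
  have hE := cyclotomic_prime_pow_comp_X_add_one_isEisensteinAt p n
  have hXC : (X + 1 : ℤ[X]) = X + C 1 := by rw [C_1]
  have hmonic : P.Monic := by
    rw [hP, hXC]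
    exact (cyclotomic.monic _ ℤ).comp_X_add_C 1
  have hdeg : P.natDegree = p ^ n * (p - 1) := by
    rw [hP, natDegree_comp, hXC, natDegree_X_add_C, mul_one, natDegree_cyclotomic,
      Nat.totient_prime_pow_succ hp.out]
  have hdvd : C (p : ℤ) ∣ P - X ^ (p ^ n * (p - 1)) := by
    rw [C_dvd_iff_dvd_coeff]
    intro m
    rw [coeff_sub, coeff_X_pow]
    rcases lt_trichotomy m (p ^ n * (p - 1)) with hm | hm | hm
    · rw [if_neg hm.ne, sub_zero]
      have hmem := hE.mem (by rw [hdeg]; exact hm)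
      rwa [Ideal.submodule_span_eq, Ideal.mem_span_singleton] at hmem
    · subst hm
      rw [if_pos rfl, ← hdeg, hmonic.coeff_natDegree, sub_self]
      exact dvd_zero _
    · rw [if_neg hm.ne', sub_zero, coeff_eq_zero_of_natDegree_lt (by rw [hdeg]; exact hm)]
      exact dvd_zero _
  obtain ⟨Q, hQ⟩ := hdvd
  have hPQ : P = X ^ (p ^ n * (p - 1)) + C (p : ℤ) * Q := by rw [← hQ]; ring
  have h0 : P.coeff 0 = p := by
    rw [coeff_zero_eq_eval_zero, hP, eval_comp, eval_add, eval_X, eval_one, zero_add,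
      eval_one_cyclotomic_prime_pow]
  have hd0 : p ^ n * (p - 1) ≠ 0 :=
    Nat.mul_ne_zero (pow_ne_zero _ hp.out.ne_zero) (by have := hp.out.two_le; omega)
  have hQ0 : Q.coeff 0 = 1 := by
    have h := congrArg (fun f : ℤ[X] ↦ f.coeff 0) hPQ
    simp only [coeff_add, coeff_X_pow, coeff_C_mul, h0, if_neg (Ne.symm hd0), zero_add] at h
    have hp0 : (p : ℤ) ≠ 0 := by exact_mod_cast hp.out.ne_zero
    have h' : (p : ℤ) * (Q.coeff 0 - 1) = 0 := by rw [mul_sub, ← h, mul_one, sub_self]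
    rcases mul_eq_zero.mp h' with h'' | h''
    · exact absurd h'' hp0
    · exact sub_eq_zero.mp h''
  obtain ⟨V, hV⟩ := (X_dvd_iff (f := Q - 1)).mpr (by rw [coeff_sub, coeff_one_zero, hQ0, sub_self])
  exact ⟨Q, V, hPQ, by rw [← hV]; ring⟩

end CyclotomicShift

/-! ## A `p`-primary group killed by `Φ_{p^(n+1)}(g)` has corank divisible by `p^n (p-1)` -/

section PrimePow

variable {B : Type*} [AddCommGroup B] {p : ℕ} [hp : Fact p.Prime] {n : ℕ} (g : AddMonoid.End B)

omit hp in
/-- `Φ_{p^(n+1)}(X + 1)` evaluated at `g - 1` is `Φ_{p^(n+1)}(g)`. [folklore] -/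
theorem aeval_sub_one_cyclotomic_prime_pow_comp :
    aeval (g - 1) ((cyclotomic (p ^ (n + 1)) ℤ).comp (X + 1)) =
      aeval g (cyclotomic (p ^ (n + 1)) ℤ) := by
  rw [aeval_comp, map_add, aeval_X, map_one, sub_add_cancel]

omit hp in
/-- **The Eisenstein relation**: if `Φ_{p^(n+1)}(g) = 0` on `B` then, with `π = g - 1` and `Q` as in
`exists_cyclotomic_prime_pow_comp_X_add_one_eq`, `π^(p^n (p-1)) + p·Q(π) = 0`. [folklore] -/
theorem pow_totient_add_eq_zero_of_aeval_cyclotomic_eq_zero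
    (hg : aeval g (cyclotomic (p ^ (n + 1)) ℤ) = 0) {Q : ℤ[X]}
    (hPQ : (cyclotomic (p ^ (n + 1)) ℤ).comp (X + 1) = X ^ (p ^ n * (p - 1)) + C (p : ℤ) * Q) :
    (g - 1) ^ (p ^ n * (p - 1)) + (p : AddMonoid.End B) * aeval (g - 1) Q = 0 := by
  have h := aeval_sub_one_cyclotomic_prime_pow_comp (p := p) (n := n) g
  rw [hg, hPQ, map_add, map_pow, aeval_X, map_mul, aeval_C, algebraMap_int_eq, eq_intCast,
    Int.cast_natCast] at h
  exact h

/-- **A `p`-primary abelian group with finite `p`-torsion killed by `Φ_{p^(n+1)}(g)`, for an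
endomorphism `g`, has `ℤ_p`-corank divisible by `φ(p^(n+1)) = p^n (p - 1)`** — a cofinitely
generated torsion `ℤ_p[ζ_{p^(n+1)}]`-module has `ℤ_p`-corank `[ℚ_p(ζ_{p^(n+1)}) : ℚ_p]` times its
`ℤ_p[ζ_{p^(n+1)}]`-corank; the content of "the unique `(p-1)p^n`-dimensional `ℚ_p`-irreducible
`p`-adic representation" of a cyclic group of order `p^(n+1)` (Dokchitser–Dokchitser 2010, §4.6,
p. 27). The Eisenstein engine applied to `π = g - 1`.
[cite: DokchitserDokchitserAnnals2010, §4.6, proof of Thm. 4.19 (p. 27)] -/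
theorem exists_zpCorank_eq_totient_mul_of_aeval_cyclotomic_eq_zero
    (hg : aeval g (cyclotomic (p ^ (n + 1)) ℤ) = 0)
    (hB : ∀ b : B, ∃ m : ℕ, p ^ m • b = 0) [Finite B[(p : ℤ)]] :
    ∃ a : ℕ, zpCorank B p = p ^ n * (p - 1) * a := by
  obtain ⟨Q, V, hPQ, hQV⟩ := exists_cyclotomic_prime_pow_comp_X_add_one_eq p n
  have hd : p ^ n * (p - 1) ≠ 0 :=
    Nat.mul_ne_zero (pow_ne_zero _ hp.out.ne_zero) (by have := hp.out.two_le; omega)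
  exact exists_zpCorank_eq_mul_of_pow_add_eq_zero
    (pow_totient_add_eq_zero_of_aeval_cyclotomic_eq_zero g hg hPQ) hQV hd hB

end PrimePow

/-! ## An endomorphism `g` with `g^(p^(n+1)) = 1`: `corank A = corank A^(g^(p^n)) + p^n (p-1)·a` -/

section OrderPrimePow

variable {A : Type*} [AddCommGroup A] {p : ℕ} [hp : Fact p.Prime]

/-- **`corank A = corank A^σ + corank ker N_σ`** for `σ^p = 1` on a `p`-primary `A` with finite
`A[p]`: `A^σ × ker N_σ → A`, `(a, b) ↦ a + b`, has kernel and cokernel killed by `p`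
(`nsmul_eq_zero_of_fixedKerMap_eq_zero`, `nsmul_mem_range_fixedKerMap`), and the corank is
additive and invariant under such quasi-isomorphisms (`ZpCorankQuasiIso`). This is the
decomposition inside `exists_zpCorank_eq_zpCorank_fixedSub_add`, exposed for reuse.
[cite: DokchitserDokchitserAnnals2010, Cor. 4.15 (proof)] -/
theorem zpCorank_eq_zpCorank_fixedSub_add_zpCorank_kerNorm {σ : AddMonoid.End A} (hσ : σ ^ p = 1)
    (hA : ∀ a : A, ∃ n : ℕ, p ^ n • a = 0) [Finite A[(p : ℤ)]] :
    zpCorank A p = zpCorank (fixedSub σ) p + zpCorank (kerNorm σ p) p := by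
  obtain ⟨hF, hFfin⟩ := primary_and_finite_torsionBy_of_injective (i := (fixedSub σ).subtype)
    Subtype.val_injective hA
  obtain ⟨hB, hBfin⟩ := primary_and_finite_torsionBy_of_injective (i := (kerNorm σ p).subtype)
    Subtype.val_injective hA
  haveI := hFfin
  haveI := hBfin
  have hi : Injective (AddMonoidHom.inl (fixedSub σ) (kerNorm σ p)) := fun a b h ↦
    (Prod.ext_iff.mp h).1
  have hex : ∀ x : (fixedSub σ) × (kerNorm σ p), AddMonoidHom.snd _ _ x = 0 →
      x ∈ (AddMonoidHom.inl (fixedSub σ) (kerNorm σ p)).range :=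
    fun x hx ↦ ⟨x.1, Prod.ext rfl (by simpa using hx.symm)⟩
  have hfi : ∀ a : fixedSub σ, AddMonoidHom.snd _ (kerNorm σ p) (AddMonoidHom.inl _ _ a) = 0 :=
    fun _ ↦ rfl
  obtain ⟨hFB, hFBfin⟩ := primary_and_finite_torsionBy_of_shortExact hi hex hfi hF hB
  haveI := hFBfin
  have h1 : zpCorank ((fixedSub σ) × (kerNorm σ p)) p = zpCorank A p :=
    zpCorank_eq_of_nsmul_ker_of_nsmul_coker (fixedKerMap σ p) hFB hA hp.out.ne_zero
      nsmul_eq_zero_of_fixedKerMap_eq_zero (nsmul_mem_range_fixedKerMap hσ)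
  rw [← h1, zpCorank_prod hF hB]

omit hp in
/-- Values of a restricted endomorphism's powers: if `gS` agrees with `g` on the subgroup `S`, so
do their powers. [folklore] -/
theorem coe_pow_apply_of_coe_apply {S : AddSubgroup A} (g : AddMonoid.End A)
    (gS : AddMonoid.End S) (hgS : ∀ x : S, ((gS x : S) : A) = g x) (i : ℕ) (x : S) :
    (((gS ^ i) x : S) : A) = (g ^ i) x := by
  induction i generalizing x with
  | zero => rfl
  | succ i ih =>
    rw [pow_succ, pow_succ, AddMonoid.End.coe_mul, AddMonoid.End.coe_mul, comp_apply, comp_apply,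
      ih, hgS]

omit hp in
/-- Values of a polynomial in a restricted endomorphism: if `gS` agrees with `g` on the subgroup
`S`, then `P(gS)` agrees with `P(g)` for every `P ∈ ℤ[X]`. [folklore] -/
theorem coe_aeval_apply_of_coe_apply {S : AddSubgroup A} (g : AddMonoid.End A)
    (gS : AddMonoid.End S) (hgS : ∀ x : S, ((gS x : S) : A) = g x) (P : ℤ[X]) (x : S) :
    ((aeval gS P x : S) : A) = aeval g P x := by
  induction P using Polynomial.induction_on' with
  | add P Q hP hQ =>
    rw [map_add, map_add, addMonoidEnd_add_apply, addMonoidEnd_add_apply, AddSubgroup.coe_add,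
      hP, hQ]
  | monomial k c =>
    rw [aeval_monomial, aeval_monomial, eq_intCast, eq_intCast, AddMonoid.End.coe_mul,
      AddMonoid.End.coe_mul, comp_apply, comp_apply, AddMonoid.End.intCast_apply,
      AddMonoid.End.intCast_apply, AddSubgroupClass.coe_zsmul, coe_pow_apply_of_coe_apply g gS hgS]

/-- `N_{g^(p^n)} = 1 + g^(p^n) + ⋯ + g^(p^n (p-1)) = Φ_{p^(n+1)}(g)` (Mathlib's
`cyclotomic_prime_pow_eq_geom_sum`). [folklore] -/
theorem normEnd_pow_eq_aeval_cyclotomic (g : AddMonoid.End A) (n : ℕ) :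
    normEnd (g ^ p ^ n) p = aeval g (cyclotomic (p ^ (n + 1)) ℤ) := by
  rw [cyclotomic_prime_pow_eq_geom_sum hp.out, map_sum]
  simp only [map_pow, aeval_X, normEnd]

/-- **An endomorphism `g` with `g^(p^(n+1)) = 1` on a cofinitely generated `p`-primary group:
`corank A = corank A^(g^(p^n)) + p^n (p - 1)·a`.** With `σ = g^(p^n)` (so `σ^p = 1`),
`corank A = corank A^σ + corank ker N_σ` (`zpCorank_eq_zpCorank_fixedSub_add_zpCorank_kerNorm`),
and `ker N_σ` is `g`-stable and killed by `N_σ = Φ_{p^(n+1)}(g)`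
(`normEnd_pow_eq_aeval_cyclotomic`), so its corank is a multiple of `p^n (p - 1)`
(`exists_zpCorank_eq_totient_mul_of_aeval_cyclotomic_eq_zero`). For the `p^∞`-Selmer group over
the top layer `F = M_{n+1}` of a cyclic extension `F/M_0` of degree `p^(n+1)` with `M = M_n` the
fixed field of `σ`, this is `rk_p(E/F) = rk_p(E/M) + (p - 1)·m_ρ` with `m_ρ = p^n·a`, `a` being
"the number of copies of the unique `(p-1)p^n`-dimensional `ℚ_p`-irreducible representation"
(Dokchitser–Dokchitser 2010, §4.6, p. 27, where Cornut–Vatsal and Tian–Zhang / Nekovář give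
`a = 1`, "so `m_ρ = p^n` is odd"). [cite: DokchitserDokchitserAnnals2010, §4.6, proof of Thm. 4.19 (p. 27)] -/
theorem exists_zpCorank_eq_zpCorank_fixedSub_pow_add {g : AddMonoid.End A} {n : ℕ}
    (hg : g ^ p ^ (n + 1) = 1) (hA : ∀ a : A, ∃ m : ℕ, p ^ m • a = 0) [Finite A[(p : ℤ)]] :
    ∃ a : ℕ, zpCorank A p = zpCorank (fixedSub (g ^ p ^ n)) p + p ^ n * (p - 1) * a := by
  set σ : AddMonoid.End A := g ^ p ^ n with hσdef
  have hσ : σ ^ p = 1 := by rw [hσdef, ← pow_mul, ← pow_succ, hg]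
  obtain ⟨hB, hBfin⟩ := primary_and_finite_torsionBy_of_injective (i := (kerNorm σ p).subtype)
    Subtype.val_injective hA
  haveI := hBfin
  -- `g` commutes with `N_σ = Φ_{p^(n+1)}(g)`, hence preserves `ker N_σ`
  have hcomm : g * normEnd σ p = normEnd σ p * g := by
    rw [hσdef, normEnd_pow_eq_aeval_cyclotomic]
    have h := aeval_mul_comm g X (cyclotomic (p ^ (n + 1)) ℤ)
    rwa [aeval_X] at h
  have hmem : ∀ x : kerNorm σ p, g x ∈ kerNorm σ p := fun x ↦ by
    have hx := (mem_kerNorm_iff σ (x : A)).mp x.2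
    rw [mem_kerNorm_iff]
    change (normEnd σ p * g) x = 0
    rw [← hcomm, AddMonoid.End.coe_mul, comp_apply, hx, map_zero]
  set gB : AddMonoid.End (kerNorm σ p) :=
    ((endHom g).comp (kerNorm σ p).subtype).codRestrict (kerNorm σ p) hmem with hgBdef
  have hgB : ∀ x : kerNorm σ p, ((gB x : kerNorm σ p) : A) = g x := fun x ↦ rfl
  -- `Φ_{p^(n+1)}(gB) = 0` on `ker N_σ`
  have haeval : aeval gB (cyclotomic (p ^ (n + 1)) ℤ) = 0 := by
    refine DFunLike.ext _ _ fun x ↦ Subtype.ext ?_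
    rw [coe_aeval_apply_of_coe_apply g gB hgB, ← normEnd_pow_eq_aeval_cyclotomic, ← hσdef,
      (mem_kerNorm_iff σ (x : A)).mp x.2]
    rfl
  obtain ⟨a, ha⟩ := exists_zpCorank_eq_totient_mul_of_aeval_cyclotomic_eq_zero gB haeval hB
  exact ⟨a, by rw [zpCorank_eq_zpCorank_fixedSub_add_zpCorank_kerNorm hσ hA, ha]⟩

end OrderPrimePow

end Literature.NumberTheory.EllipticCurves

end
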